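/-
Copyright (c) 2026 the pub-hodgecm-mathlib formalisation cell (harness21).  Prover seat hodgecm-mathlib-F0P3a-p01 (g34), req620 Track A «(D-RAM) FOUR-FRAME» squad, unit U2H:
the (ρ2b′-X) child (U2H ED. 15 :418) — SOCKET (C) (type RamM) organ (C-5b) S9-RM, part Σ2 «THE FOURTH-FIELD NON-NORM UNIT AND THE LETTER hf♮» ((C) lead LH4-p04 (g5) LINE #6 (2)).
2026-09-04.
-/
import Summits.HodgeConjecture.HodgeConjecture.Theorems.F0P3cDyRamFlipUnitToken          -- ★ p857943 (this seat): `eq_sq_sub_mul_sq_of_eq_one`, `add_mul_mul_sub_mul`; brings ★ TokenSignUnr (`ω`, descent), ★ Hilbert-symbol API + bilinearity, ★ `v_eq_one_of_v_mul_map_eq_one`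
import Summits.HodgeConjecture.HodgeConjecture.Theorems.F0P3cDyRamFrameRamMDictionary     -- ★ p858161 (this seat): `even_of_tauFixed`, `v_eq_exp_two_mul_of_sq`; brings ★ `tau_tau`, `tau_rho`, `rho_tau` (LH4-p06)
import Literature.NumberTheory.LocalFields.ValuedFixedFieldRamified                       -- ★ (LH4-p12 (g5)) S2′-R `exists_valuedFixedField_ramified` (a fixed field AS A VALUED FIELD)
import Literature.NumberTheory.LocalFields.WildQuadraticDatumNonNormUnit                   -- ★ (LH4-p09) `exists_fixed_unit_not_norm_of_isRamifiedQuadraticDatum` (Serre V §3: a fixed unit non-norm)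
import Literature.NumberTheory.LocalFields.ValuedCompleteIsAdicComplete                    -- ★ `isAdicComplete_valuedInteger_of_completeSpace`
import Literature.NumberTheory.Automorphic.AdicCompletionCompact                           -- ★ `finite_residueField_adicCompletion`
import HarnessLib

/-!
# Crux `H413`, line LH4 «(D-RAM) FOUR-FRAME» road — unit U2H, (ρ2b′-X), SOCKET (C): THE FOURTH-FIELD NON-NORM UNIT AND THE LETTER `hf♮` OF THE RamM SIGN (part Σ2 of S9-RM)

Cell `hodgecm-mathlib` (D-0151), FLOOR 0, crux item H413 = `stmt-HodgeConjecture-24833`, route of record `HCCMUnconditional`; squad F0∕P3c∕LH4; registered stub served: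
`F0P3cDyRamFourFrameU2H.stub_U2H_fixedPointCensus_typeTwo_unit0` ((ρ2b′-X), U2H ED. 15 :418) through the typed bottom socket (C) `SOCKET-hOCC.v1` (869d0c15; type RamM,
`e(M ∕ L⁺_v) = 4`): the ONE RamM-specific input `hf` of part Σ1 ★∕cand `F0P3cDyRamSideNormCriterionRamM.side_iff_exists_norm_ramM` —
**`hf♮ : ∃ a, Θ a = a ∧ |a| = 1 ∧ ¬ ∃ e, ρ e = e ∧ e·Θe = a·ρa`** («`N_{K♮∕F}(U_{K♮}) ⊄ N_{E∕F}(U_E)`», `K♮ = Fix Θ`, `E = Fix ρ`, `K = Fix τ`, `τ = Θρ`, `F = L⁺_v`) —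
DISCHARGED at the CM place.  THEOREMS ONLY (no `def`, no instance, no notation, no `sorry`); lane `--supports stmt-HodgeConjecture-24833 --as helper` (count-neutral).

THE ARGUMENT (Serre V §3 Cor. 3 twice + bimultiplicativity of the local Hilbert symbol over `L⁺_v`; no norm-index computation for the biquadratic `M ∕ F`).
* §1 (one field, `exists_fixed_fixed_unit_not_tauNorm`) — THE FOURTH-FIELD NON-NORM UNIT: `M` complete with finite residue field, `ρ, Θ` commuting isometric involutions,
  `τ = Θρ` RESIDUALLY TRIVIAL, doubly fixed non-zero elements of valuation in `exp(4ℤ)` (`hF4`, ★ p858161's letter), `2 ≠ 0`, `ϖM` a uniformiser.  Then there is a doubly fixed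
  unit `f₁` which is NOT `k·ρk` for any `τ`-fixed `k` («`U_F ⊄ N_{K∕F}(K^×)`»): the fourth field `K = Fix τ` is produced AS A VALUED FIELD by ★ `exists_valuedFixedField_ramified`
  at the pair `(τ, ρ)` (`P := ϖM·τϖM`), it carries the ramified datum `(σ' = ρ|, π', d₄, t₄)` (clause 4 from `hF4`, `d₄` = half the `M`-order of `P − ρP`, `t₄` = half that of `2`),
  and ★ `exists_fixed_unit_not_norm_of_isRamifiedQuadraticDatum` gives the unit, pushed forward along `jK`.
* §2 (CM place, frame of ★ p857943: `M ⊇ jE(L_w)`, `Fix ρ = jE(L_w)`, `Θ ∘ jE = jE ∘ σ_w`, a doubly ANTI-fixed `ξ ≠ 0` — `exists_antifixed_of_lam` builds it from the eigen-letter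
  `lam`) — `exists_thetaFixed_unit_not_rhoNorm`: from `f₁` (§1) and a doubly fixed unit `y₁` which is not an `E`-norm `e·Θe`, `ρe = e` (`exists_fixed_fixed_unit_not_rhoNorm_of_datum`:
  the `E ∕ F` datum on `L_w` and ★ Serre V §3), descend `f₁ = jE ι b`, `y₁ = jE ι y₀`, `ξ² = jE ι c`; then `(b, c)_v = −1` (else `b = p² − c q²` and `k := jE ι p + jE ι q·ξ` is
  `τ`-fixed with `k·ρk = f₁`) and `(y₀, θ)_v = −1` (★ `hilbertSymbol_eq_one_iff_exists_norm_toPlace`); by BIMULTIPLICATIVITY (★ `hilbertSymbol_adicCompletion_mul_left∕right`) one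
  of `u ∈ {b, y₀, b·y₀}` has `(u, θ)_v = −1` and `(u, θc)_v = +1`; `u = p² − θc·q²` makes `a := jE ι p + jE ι q·(jE ω·ξ)` a `Θ`-FIXED unit with `a·ρa = jE ι u`, and an `E`-norm
  `e·Θe = jE ι u` with `ρe = e` would force `(u, θ)_v = 1`.  `exists_thetaFixed_unit_not_rhoNorm_ramM` assembles §1 + §2 in the socket letters.
(R-26) inhabitant: ℚ₂(ζ₈) ⊃ E = ℚ₂(i), F = ℚ₂: `N(U_E) ≡ {1,5}`, `N(U_{ℚ₂(√2)}) ≡ {1,7}`, `N(U_{ℚ₂(√−2)}) ≡ {1,3} (mod 8)` — pairwise distinct, as bimultiplicativity predicts.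
HONEST LABEL.  Count-neutral helper; (ρ2b′-X) stays an OPEN prover target; `HC_CM` is proved only modulo the 7 printed citations (2 remaining named inputs: hLiu418 =
`stmt-HodgeConjecture-24832`, h413 = `stmt-HodgeConjecture-24833`) until rung 0 closes.

## References
* [Serre1979] J.-P. Serre, *Local Fields*, GTM 67 (1979), Ch. V §3 Cor. 3 p. 86 (norm index two ⇒ a unit non-norm), Ch. XIV §2–§3 (local symbols, bimultiplicativity).
* [Omeara1963] O. T. O'Meara, *Introduction to Quadratic Forms* (1963), §63B (63:10, 63:13a) (the Hilbert symbol and binary norm forms).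
* [Rogawski1990] J. D. Rogawski, *Automorphic Representations of Unitary Groups in Three Variables*, Ann. of Math. Stud. 123 (1990), §4.9 Lemma 4.9.3 p. 56 (the eigen-field
  `M = E·K` with its two involutions).
-/

set_option autoImplicit false

noncomputable section

open WithZero IsLocalRing
open Literature.NumberTheory.Automorphic.UnitaryThreeFourFrame (IsRamifiedQuadraticDatum)
open Literature.NumberTheory.LocalFields.WildQuadraticDatum
open Literature.NumberTheory.LocalFields.ValuedFixedFieldRamified (exists_valuedFixedField_ramified)
open Summit.HodgeConjecture.HodgeConjecture.Cruxes.H413.F0P3cDyRamToricLevelCensusRamM (tau_tau tau_rho rho_tau)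
open Summit.HodgeConjecture.HodgeConjecture.Cruxes.H413.F0P3cDyRamFrameRamMDictionary (even_of_tauFixed v_eq_exp_two_mul_of_sq)
open Summit.HodgeConjecture.HodgeConjecture.Cruxes.H413.F0P3cDyRamFlipUnitToken (eq_sq_sub_mul_sq_of_eq_one add_mul_mul_sub_mul)
open scoped Valued

namespace Summit.HodgeConjecture.HodgeConjecture.Cruxes.H413.F0P3cDyRamFourthFieldNonNormUnit

/-! ## §1 One field: the fourth-field non-norm unit -/

section OneField

variable {K : Type} [Field K] [Valued K ℤᵐ⁰] {ρ Θ τ : K →+* K}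

/-- **THE FOURTH-FIELD NON-NORM UNIT** («`U_F ⊄ N_{K∕F}(K^×)`, `K = Fix τ`, `τ = Θρ` residually trivial, `e(M ∕ F) = 4`): a unit `f₁` fixed by `ρ` and `Θ` with no `τ`-fixed `k`,
`k·ρk = f₁`.  See the module docstring, §1. [cite: Serre1979, Ch. V §3 Cor. 3 p. 86] [cite: Rogawski1990, §4.9 Lemma 4.9.3 p. 56] -/
theorem exists_fixed_fixed_unit_not_tauNorm [CompleteSpace K] [Finite 𝓀[K]]
    (hτ : ∀ x, τ x = Θ (ρ x)) (hρρ : ∀ x, ρ (ρ x) = x) (hvρ : ∀ x, Valued.v (ρ x) = Valued.v x)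
    (hΘΘ : ∀ x, Θ (Θ x) = x) (hvΘ : ∀ x, Valued.v (Θ x) = Valued.v x) (hΘρ : ∀ x, Θ (ρ x) = ρ (Θ x))
    (hτres : ∀ x : K, Valued.v x ≤ 1 → Valued.v (x - τ x) < 1)
    (hF4 : ∀ f : K, ρ f = f → τ f = f → f ≠ 0 → ∃ n : ℤ, Valued.v f = exp (4 * n))
    (h20 : (2 : K) ≠ 0) {ϖM : K} (hϖM : Valued.v ϖM = exp (-1 : ℤ)) :
    ∃ f₁ : K, ρ f₁ = f₁ ∧ Θ f₁ = f₁ ∧ Valued.v f₁ = 1 ∧ ¬ ∃ k : K, τ k = k ∧ k * ρ k = f₁ := by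
  classical
  have hττ : ∀ x, τ (τ x) = x := tau_tau hτ hρρ hΘΘ hΘρ
  have hvτ : ∀ x, Valued.v (τ x) = Valued.v x := fun x => by rw [hτ, hvΘ, hvρ]
  have hτρ : ∀ x, τ (ρ x) = ρ (τ x) := fun x => by rw [tau_rho hτ hρρ, rho_tau hτ hρρ hΘρ]
  have hevτ : ∀ z : K, τ z = z → z ≠ 0 → ∃ n : ℤ, Valued.v z = exp (2 * n) := fun z hz hz0 =>
    even_of_tauFixed hτ hρρ hΘΘ hvΘ hF4 hz hz0
  -- the `τ`-fixed `P := ϖM · τ ϖM` of valuation `exp(−2)`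
  have hτP : τ (ϖM * τ ϖM) = ϖM * τ ϖM := by rw [map_mul, hττ, mul_comm]
  have hP : Valued.v (ϖM * τ ϖM) = exp (-2 : ℤ) := by rw [Valuation.map_mul, hvτ, hϖM, ← exp_add]; rfl
  set P : K := ϖM * τ ϖM with hPdef
  -- ### the fourth field `K' = Fix τ` as a valued field (★ S2′-R at the pair `(τ, ρ)`)
  obtain ⟨K', _iF, _iV, σ', π', jK, _hDVR, hfin, _hcard, hcomp, hσ'σ', hvσ', hjv2, _hjle, hτj, hjsurj, hjσ', hπ', hjπ', _hres⟩ :=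
    exists_valuedFixedField_ramified hττ hvτ hτres hevτ hρρ hvρ hτρ hτP hP
  haveI : CompleteSpace K' := hcomp
  haveI : Finite 𝓀[K'] := hfin
  haveI : IsAdicComplete 𝓂[K'] 𝒪[K'] := Literature.NumberTheory.LocalFields.isAdicComplete_valuedInteger_of_completeSpace hπ'
  have hjinj : Function.Injective jK := jK.injective
  have hρj : ∀ x : K', σ' x = x → ρ (jK x) = jK x := fun x hx => by rw [← hjσ', hx]
  -- ### the ramified datum `(σ', π', d₄, t₄)` on `K'`
  -- clause 4: `σ'`-fixed non-zero elements have even order (their images are doubly fixed: order in `exp(4ℤ)`)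
  have hfix' : ∀ x : K', σ' x = x → x ≠ 0 → ∃ n : ℤ, Valued.v x = exp (2 * n) := by
    intro x hx hx0
    obtain ⟨n, hn⟩ := hF4 (jK x) (hρj x hx) (hτj x) ((map_ne_zero jK).2 hx0)
    have h := hjv2 x
    rw [hn, sq] at h
    exact ⟨n, v_eq_exp_two_mul_of_sq h.symm⟩
  -- clause 5: the different exponent `d₄`, read off `|P − ρP| = exp(2m)`, `m ≤ −1`
  have hP0 : P ≠ 0 := fun h => by rw [h, map_zero] at hP; exact (exp_ne_zero hP.symm).elim
  have hPρ : P - ρ P ≠ 0 := by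
    intro h0
    obtain ⟨n, hn⟩ := hF4 P (sub_eq_zero.1 h0).symm hτP hP0
    rw [hP, exp_inj] at hn
    omega
  have hτPρ : τ (P - ρ P) = P - ρ P := by rw [map_sub, hτρ, hτP]
  obtain ⟨m, hm⟩ := hevτ _ hτPρ hPρ
  have hmle : m ≤ -1 := by
    have h1 : Valued.v (P - ρ P) ≤ exp (-2 : ℤ) := by
      refine (Valuation.map_sub _ _ _).trans ?_
      rw [hvρ, hP, max_self]
    rw [hm, exp_le_exp] at h1; omega
  obtain ⟨d₄, hd₄⟩ := Int.eq_ofNat_of_zero_le (show (0 : ℤ) ≤ -m by omega)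
  have hsq : Valued.v (π' - σ' π') ^ 2 = exp (2 * m) := by rw [← hjv2, map_sub, hjσ', hjπ', hm]
  have hroot : Valued.v (π' - σ' π') = exp m := by
    refine (pow_left_inj₀ zero_le zero_le two_ne_zero).1 ?_
    rw [hsq, ← exp_nsmul, nsmul_eq_mul]; congr 1
  have hdd' : Valued.v (π' - σ' π') = Valued.v π' ^ d₄ := by
    rw [hroot, hπ', ← exp_nsmul, nsmul_eq_mul]; congr 1; omega
  -- clause 7: `|2| = |π'|^{t₄}` (`2` is doubly fixed and non-zero)
  obtain ⟨n₂, hn₂⟩ := hF4 2 (map_ofNat ρ 2) (map_ofNat τ 2) h20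
  have h2le : Valued.v (2 : K) ≤ 1 := by
    rw [show (2 : K) = 1 + 1 by norm_num]
    exact (Valuation.map_add _ _ _).trans (by rw [Valuation.map_one, max_self])
  have hn₂le : n₂ ≤ 0 := by rw [hn₂, ← exp_zero, exp_le_exp] at h2le; omega
  have hv2' : Valued.v (2 : K') = exp (2 * n₂) := by
    have h := hjv2 2
    rw [map_ofNat, hn₂, sq] at h
    exact v_eq_exp_two_mul_of_sq h.symm
  obtain ⟨t₄, ht₄⟩ := Int.eq_ofNat_of_zero_le (show (0 : ℤ) ≤ -(2 * n₂) by omega)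
  have ht' : Valued.v (2 : K') = Valued.v π' ^ t₄ := by
    rw [hv2', hπ', ← exp_nsmul, nsmul_eq_mul]; congr 1; omega
  have hD4 : IsRamifiedQuadraticDatum σ' π' d₄ t₄ := ⟨hσ'σ', hvσ', hπ', hfix', hdd', by omega, ht'⟩
  -- ### Serre V §3 Cor. 3 in `K'`, pushed forward along `jK`
  obtain ⟨u', hσu', hvu', hu'N⟩ := exists_fixed_unit_not_norm_of_isRamifiedQuadraticDatum σ' π' d₄ t₄ hD4
  refine ⟨jK u', hρj u' hσu', ?_, ?_, ?_⟩
  · rw [← tau_rho hτ hρρ (jK u'), hρj u' hσu', hτj]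
  · rw [hjv2, hvu', one_pow]
  · rintro ⟨k, hτk, hk⟩
    obtain ⟨k', rfl⟩ := hjsurj k hτk
    exact hu'N ⟨k', hjinj (by rw [map_mul, hjσ', hk])⟩

end OneField

/-! ## §2 The CM place: three Hilbert symbols over `L⁺_v` -/

section CM

open NumberField IsDedekindDomain
open Literature.NumberTheory.Automorphic Literature.NumberTheory.Automorphic.UnitaryGroup
open Literature.NumberTheory.QuadraticForms Literature.NumberTheory.Rogawski1990

variable (L : Type) [Field L] [NumberField L] [IsCMField L] {v : HeightOneSpectrum (𝓞 ↥(maximalRealSubfield L))}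
  (w : PlacesOver L v) (hw : IsCMField.complexConj L • w.1 = w.1)

include hw in
/-- **A DOUBLY ANTI-FIXED `ξ ≠ 0`** (`ρξ = −ξ`, `Θξ = −ξ`) from the eigen-letter `lam` (`Θ lam·lam = 1`, `ρ lam ≠ lam`): one of `(lam − Θlam) − ρ(lam − Θlam)`,
`jE ω·((lam + Θlam) − ρ(lam + Θlam))` (`ω² = ι θ`, `σ_w ω = −ω`) — the construction inside ★ p857943, exported. [cite: Rogawski1990, §4.9 Lemma 4.9.3 p. 56] -/
theorem exists_antifixed_of_lam {M : Type} [Field M] (jE : w.1.adicCompletion L →+* M) (ρ Θ : M →+* M)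
    (hρρ : ∀ z, ρ (ρ z) = z) (hjfix : ∀ z : M, ρ z = z ↔ ∃ a, jE a = z)
    (hΘj : ∀ a, Θ (jE a) = jE (galAdicCompletionMap (L := L) (IsCMField.complexConj L) hw a)) (hΘρ : ∀ z, Θ (ρ z) = ρ (Θ z))
    {lam : M} (hΘlam : Θ lam * lam = 1) (hρlam : ρ lam ≠ lam) :
    ∃ ξ : M, ξ ≠ 0 ∧ ρ ξ = -ξ ∧ Θ ξ = -ξ := by
  classical
  haveI : CharZero (w.1.adicCompletion L) := charZero_of_injective_algebraMap (algebraMap L (w.1.adicCompletion L)).injective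
  have hjinj : Function.Injective jE := jE.injective
  have h2M : (2 : M) ≠ 0 := by rw [← map_ofNat jE 2]; exact (map_ne_zero_iff jE hjinj).2 two_ne_zero
  obtain ⟨ω, hω0, hσω, -⟩ := F0P3cDyRamTokenSignUnr.exists_antifixed_sq_eq_toPlace_cmQuadraticGenerator L w hw
  have hΘω : Θ (jE ω) = -jE ω := by rw [hΘj, hσω, map_neg]
  have hρω : ρ (jE ω) = jE ω := (hjfix (jE ω)).2 ⟨ω, rfl⟩
  have hlam0 : lam ≠ 0 := fun h0 => by rw [h0, mul_zero] at hΘlam; exact zero_ne_one hΘlam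
  have hΘl : Θ lam = lam⁻¹ := eq_inv_of_mul_eq_one_left hΘlam
  have hΘΘl : Θ (Θ lam) = lam := by rw [hΘl, map_inv₀, hΘl, inv_inv]
  have hΘρl : Θ (ρ lam) = ρ (Θ lam) := hΘρ lam
  have hΘρΘl : Θ (ρ (Θ lam)) = ρ lam := by rw [hΘρ, hΘΘl]
  by_cases h2 : (lam - Θ lam) - ρ (lam - Θ lam) = 0
  · refine ⟨jE ω * ((lam + Θ lam) - ρ (lam + Θ lam)), mul_ne_zero ((map_ne_zero_iff jE hjinj).2 hω0) ?_, ?_, ?_⟩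
    · intro h1
      apply hρlam
      have e1 : ρ (lam + Θ lam) = lam + Θ lam := by linear_combination -h1
      have e2 : ρ (lam - Θ lam) = lam - Θ lam := by linear_combination -h2
      have e3 : ρ (2 * lam) = 2 * lam := by
        rw [show 2 * lam = (lam + Θ lam) + (lam - Θ lam) by ring, map_add, e1, e2]
      rw [map_mul, map_ofNat] at e3
      exact mul_left_cancel₀ h2M e3
    · simp only [map_mul, map_sub, map_add, hρω, hρρ]; ring
    · simp only [map_mul, map_sub, map_add, hΘω, hΘΘl, hΘρl, hΘρΘl]; ring
  · refine ⟨(lam - Θ lam) - ρ (lam - Θ lam), h2, ?_, ?_⟩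
    · simp only [map_sub, hρρ]; ring
    · simp only [map_sub, hΘΘl, hΘρl, hΘρΘl]; ring

include hw in
/-- **THE `E`-SIDE NON-NORM UNIT, IN `M`**: from the ramified datum of `E ∕ F = L_w ∕ L⁺_v` (★ Serre V §3 Cor. 3 on `L_w`) a unit `y₁ = jE y` fixed by `ρ` and `Θ` which is not
`e·Θe` with `ρe = e`.  (`hjv`: `jE` preserves integrality both ways.) [cite: Serre1979, Ch. V §3 Cor. 3 p. 86] -/
theorem exists_fixed_fixed_unit_not_rhoNorm_of_datum {M : Type} [Field M] [Valued M ℤᵐ⁰] (jE : w.1.adicCompletion L →+* M) (ρ Θ : M →+* M)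
    (hjfix : ∀ z : M, ρ z = z ↔ ∃ a, jE a = z)
    (hΘj : ∀ a, Θ (jE a) = jE (galAdicCompletionMap (L := L) (IsCMField.complexConj L) hw a))
    (hjv : ∀ a, Valued.v (jE a) ≤ 1 ↔ Valued.v a ≤ 1)
    {ϖ : w.1.adicCompletion L} {d tE : ℕ} (hD : IsRamifiedQuadraticDatum (galAdicCompletionMap (L := L) (IsCMField.complexConj L) hw) ϖ d tE) :
    ∃ y₁ : M, ρ y₁ = y₁ ∧ Θ y₁ = y₁ ∧ Valued.v y₁ = 1 ∧ ¬ ∃ e : M, ρ e = e ∧ e * Θ e = y₁ := by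
  classical
  haveI : Finite 𝓀[w.1.adicCompletion L] := finite_residueField_adicCompletion L w.1
  haveI : IsAdicComplete 𝓂[w.1.adicCompletion L] 𝒪[w.1.adicCompletion L] :=
    Literature.NumberTheory.LocalFields.isAdicComplete_valuedInteger_of_completeSpace hD.2.2.1
  obtain ⟨y, hσy, hvy, hyN⟩ := exists_fixed_unit_not_norm_of_isRamifiedQuadraticDatum _ ϖ d tE hD
  have hy0 : y ≠ 0 := fun h0 => by rw [h0, map_zero] at hvy; exact zero_ne_one hvy
  refine ⟨jE y, (hjfix (jE y)).2 ⟨y, rfl⟩, by rw [hΘj, hσy], ?_, ?_⟩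
  · refine le_antisymm ((hjv y).2 hvy.le) ?_
    have h1 : Valued.v (jE y⁻¹) ≤ 1 := (hjv y⁻¹).2 (by rw [map_inv₀, hvy, inv_one])
    rw [map_inv₀, map_inv₀] at h1
    have hj0 : Valued.v (jE y) ≠ 0 := (Valuation.ne_zero_iff _).2 ((map_ne_zero jE).2 hy0)
    exact (inv_le_one₀ (zero_lt_iff.2 hj0)).1 h1
  · rintro ⟨e, hρe, he⟩
    obtain ⟨e', rfl⟩ := (hjfix e).1 hρe
    rw [hΘj, ← map_mul] at he
    exact hyN ⟨e', jE.injective he⟩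

include hw in
/-- **THE LETTER `hf♮` AT THE CM PLACE** («`N_{K♮∕F}(U_{K♮}) ⊄ N(U_E)`»).  Frame of ★ p857943 (`M ⊇ jE(L_w)`, `Fix ρ = jE(L_w)`, `Θ ∘ jE = jE ∘ σ_w`, `ρ` isometric), a doubly
anti-fixed `ξ ≠ 0`, the fourth-field non-norm unit `f₁` (§1) and the `E`-side non-norm unit `y₁`: then some `Θ`-fixed unit `a` has `a·ρa ≠ e·Θe` for every `ρ`-fixed `e`.
Three Hilbert symbols over `L⁺_v` and bimultiplicativity — see the module docstring, §2. [cite: Serre1979, Ch. V §3 Cor. 3 p. 86; Ch. XIV §2–§3]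
[cite: Omeara1963, §63B (63:10, 63:13a)] [cite: Rogawski1990, §4.9 Lemma 4.9.3 p. 56] -/
theorem exists_thetaFixed_unit_not_rhoNorm {M : Type} [Field M] [Valued M ℤᵐ⁰] (jE : w.1.adicCompletion L →+* M) (ρ Θ : M →+* M)
    (hvρ : ∀ z, Valued.v (ρ z) = Valued.v z) (hjfix : ∀ z : M, ρ z = z ↔ ∃ a, jE a = z)
    (hΘj : ∀ a, Θ (jE a) = jE (galAdicCompletionMap (L := L) (IsCMField.complexConj L) hw a))
    {ξ : M} (hξ0 : ξ ≠ 0) (hρξ : ρ ξ = -ξ) (hΘξ : Θ ξ = -ξ)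
    (hf₁ : ∃ f₁ : M, ρ f₁ = f₁ ∧ Θ f₁ = f₁ ∧ Valued.v f₁ = 1 ∧ ¬ ∃ k : M, Θ (ρ k) = k ∧ k * ρ k = f₁)
    (hy₁ : ∃ y₁ : M, ρ y₁ = y₁ ∧ Θ y₁ = y₁ ∧ Valued.v y₁ = 1 ∧ ¬ ∃ e : M, ρ e = e ∧ e * Θ e = y₁) :
    ∃ a : M, Θ a = a ∧ Valued.v a = 1 ∧ ¬ ∃ e : M, ρ e = e ∧ e * Θ e = a * ρ a := by
  classical
  set σ := galAdicCompletionMap (L := L) (IsCMField.complexConj L) hw with hσdef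
  haveI : CharZero (w.1.adicCompletion L) := charZero_of_injective_algebraMap (algebraMap L (w.1.adicCompletion L)).injective
  have hjinj : Function.Injective jE := jE.injective
  have h2M : (2 : M) ≠ 0 := by rw [← map_ofNat jE 2]; exact (map_ne_zero_iff jE hjinj).2 two_ne_zero
  -- the embedding `ι = jE ∘ ι_w` of `L⁺_v` and its fixedness
  have hσι : ∀ p : v.adicCompletion ↥(maximalRealSubfield L), σ (toPlace v w p) = toPlace v w p := fun p =>
    galAdicCompletionMap_toPlace (IsCMField.complexConj L) w w hw p
  have hΘι : ∀ p : v.adicCompletion ↥(maximalRealSubfield L), Θ (jE (toPlace v w p)) = jE (toPlace v w p) := fun p => by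
    rw [hΘj, hσι]
  have hρι : ∀ a : w.1.adicCompletion L, ρ (jE a) = jE a := fun a => (hjfix (jE a)).2 ⟨a, rfl⟩
  -- descent of doubly fixed elements to `L⁺_v`
  have hdesc : ∀ z : M, ρ z = z → Θ z = z → ∃ p : v.adicCompletion ↥(maximalRealSubfield L), jE (toPlace v w p) = z := by
    intro z hρz hΘz
    obtain ⟨a, rfl⟩ := (hjfix z).1 hρz
    have hσa : σ a = a := hjinj (by rw [← hΘj]; exact hΘz)
    obtain ⟨p, hp⟩ := F0P3cDyRamTokenSignUnr.exists_toPlace_eq_of_fixed L w hw a hσa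
    exact ⟨p, by rw [hp]⟩
  obtain ⟨f₁, hρf, hΘf, hvf, hfN⟩ := hf₁
  obtain ⟨y₁, hρy, hΘy, hvy, hyN⟩ := hy₁
  obtain ⟨b, hb⟩ := hdesc f₁ hρf hΘf
  obtain ⟨y₀, hy₀⟩ := hdesc y₁ hρy hΘy
  have hf0 : f₁ ≠ 0 := fun h0 => by rw [h0, map_zero] at hvf; exact zero_ne_one hvf
  have hb0 : b ≠ 0 := fun h0 => hf0 (by rw [← hb, h0, map_zero, map_zero])
  have hy10 : y₁ ≠ 0 := fun h0 => by rw [h0, map_zero] at hvy; exact zero_ne_one hvy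
  have hy00 : y₀ ≠ 0 := fun h0 => hy10 (by rw [← hy₀, h0, map_zero, map_zero])
  -- `√θ ∈ L_w`
  obtain ⟨ω, hω0, hσω, hωsq⟩ := F0P3cDyRamTokenSignUnr.exists_antifixed_sq_eq_toPlace_cmQuadraticGenerator L w hw
  set θv : v.adicCompletion ↥(maximalRealSubfield L) :=
    algebraMap ↥(maximalRealSubfield L) (v.adicCompletion ↥(maximalRealSubfield L)) ((cmQuadraticGenerator L : 𝓞 ↥(maximalRealSubfield L)) : ↥(maximalRealSubfield L)) with hθv
  have hθ0 : θv ≠ 0 := by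
    intro h0
    rw [h0, map_zero] at hωsq
    exact hω0 (pow_eq_zero_iff (n := 2) (by norm_num) |>.1 hωsq)
  have hΘω : Θ (jE ω) = -jE ω := by rw [hΘj, hσω, map_neg]
  have hρω : ρ (jE ω) = jE ω := hρι ω
  -- `ξ² = jE (ι_w c)`
  have hρξ2 : ρ (ξ ^ 2) = ξ ^ 2 := by rw [map_pow, hρξ, neg_sq]
  have hΘξ2 : Θ (ξ ^ 2) = ξ ^ 2 := by rw [map_pow, hΘξ, neg_sq]
  obtain ⟨c, hc⟩ := hdesc (ξ ^ 2) hρξ2 hΘξ2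
  have hc0 : c ≠ 0 := fun h0 => by
    rw [h0, map_zero, map_zero] at hc
    exact pow_ne_zero 2 hξ0 hc.symm
  -- ### `(b, c)_v = −1`: otherwise `f₁ = k·ρk` with `k` `τ`-fixed
  have hbc : hilbertSymbol (v.adicCompletion ↥(maximalRealSubfield L)) b c = -1 := by
    rw [← hilbertSymbol_ne_one_iff]
    intro hbc1
    obtain ⟨x, y, hxy⟩ := (hilbertSymbol_eq_one_iff b c).1 hbc1
    have hx : x ≠ 0 := by
      intro hx0
      rw [hx0] at hxy
      have hcy : c * y ^ 2 = 1 := by linear_combination hxy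
      have hsq : (ξ * jE (toPlace v w y)) ^ 2 = 1 := by
        rw [mul_pow, ← hc, ← map_pow, ← map_pow, ← map_mul, ← map_mul, hcy, map_one, map_one]
      have hρP : ρ (ξ * jE (toPlace v w y)) = -(ξ * jE (toPlace v w y)) := by rw [map_mul, hρξ, hρι]; ring
      rw [sq] at hsq
      rcases mul_self_eq_one_iff.1 hsq with h1 | h1
      · rw [h1, map_one] at hρP; exact h2M (by linear_combination hρP)
      · rw [h1, map_neg, map_one] at hρP; exact h2M (by linear_combination -hρP)
    have hbpq := eq_sq_sub_mul_sq_of_eq_one hx hxy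
    apply hfN
    refine ⟨jE (toPlace v w x⁻¹) + jE (toPlace v w (y / x)) * ξ, ?_, ?_⟩
    · rw [map_add, map_mul, hρι, hρι, hρξ, map_add, map_mul, map_neg, hΘι, hΘι, hΘξ]
      ring
    · have hρk : ρ (jE (toPlace v w x⁻¹) + jE (toPlace v w (y / x)) * ξ) = jE (toPlace v w x⁻¹) - jE (toPlace v w (y / x)) * ξ := by
        rw [map_add, map_mul, hρι, hρι, hρξ]; ring
      rw [hρk, add_mul_mul_sub_mul, ← hc, ← hb, hbpq]
      simp only [map_sub, map_mul, map_pow]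
  -- ### `(y₀, θ)_v = −1`: otherwise `y₁` is an `E`-norm
  have hyθ : hilbertSymbol (v.adicCompletion ↥(maximalRealSubfield L)) y₀ θv = -1 := by
    rw [← hilbertSymbol_ne_one_iff]
    intro h1
    obtain ⟨e, he⟩ := (hilbertSymbol_eq_one_iff_exists_norm_toPlace L v w hw hy00).1 h1
    exact hyN ⟨jE e, hρι e, by rw [hΘj, ← map_mul, mul_comm, he, hy₀]⟩
  -- ### a unit `u` downstairs with `(u, θ)_v = −1`, `(u, θc)_v = 1` yields the witness
  have key : ∀ u : v.adicCompletion ↥(maximalRealSubfield L), u ≠ 0 → Valued.v (jE (toPlace v w u)) = 1 →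
      hilbertSymbol (v.adicCompletion ↥(maximalRealSubfield L)) u θv = -1 →
      hilbertSymbol (v.adicCompletion ↥(maximalRealSubfield L)) u (θv * c) = 1 →
      ∃ a : M, Θ a = a ∧ Valued.v a = 1 ∧ ¬ ∃ e : M, ρ e = e ∧ e * Θ e = a * ρ a := by
    intro u hu0 hvu huθ huθc
    obtain ⟨x, y, hxy⟩ := (hilbertSymbol_eq_one_iff u (θv * c)).1 huθc
    have hx : x ≠ 0 := by
      intro hx0
      rw [hx0] at hxy
      have hcy : θv * c * y ^ 2 = 1 := by linear_combination hxy
      have hsq : (jE ω * ξ * jE (toPlace v w y)) ^ 2 = 1 := by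
        rw [mul_pow, mul_pow, ← map_pow, hωsq, ← hc, ← map_pow, ← map_pow, ← map_mul, ← map_mul, ← map_mul, ← map_mul, hcy, map_one, map_one]
      have hρP : ρ (jE ω * ξ * jE (toPlace v w y)) = -(jE ω * ξ * jE (toPlace v w y)) := by rw [map_mul, map_mul, hρω, hρξ, hρι]; ring
      rw [sq] at hsq
      rcases mul_self_eq_one_iff.1 hsq with h1 | h1
      · rw [h1, map_one] at hρP; exact h2M (by linear_combination hρP)
      · rw [h1, map_neg, map_one] at hρP; exact h2M (by linear_combination -hρP)
    have hupq := eq_sq_sub_mul_sq_of_eq_one hx hxy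
    set a : M := jE (toPlace v w x⁻¹) + jE (toPlace v w (y / x)) * (jE ω * ξ) with ha
    have hΘa : Θ a = a := by
      rw [ha, map_add, map_mul, map_mul, hΘι, hΘι, hΘω, hΘξ, neg_mul_neg]
    have hρa : ρ a = jE (toPlace v w x⁻¹) - jE (toPlace v w (y / x)) * (jE ω * ξ) := by
      rw [ha, map_add, map_mul, map_mul, hρι, hρι, hρω, hρξ]; ring
    have haρa : a * ρ a = jE (toPlace v w u) := by
      rw [hρa, ha, add_mul_mul_sub_mul, mul_pow, ← map_pow jE ω, hωsq, ← hc, hupq]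
      simp only [map_sub, map_mul, map_pow]
    refine ⟨a, hΘa, v_eq_one_of_v_mul_map_eq_one (σ := ρ) hvρ (by rw [haρa, hvu]), ?_⟩
    rintro ⟨e, hρe, he⟩
    obtain ⟨e', rfl⟩ := (hjfix e).1 hρe
    rw [hΘj, ← map_mul, haρa] at he
    have h1 : hilbertSymbol (v.adicCompletion ↥(maximalRealSubfield L)) u θv = 1 :=
      (hilbertSymbol_eq_one_iff_exists_norm_toPlace L v w hw hu0).2 ⟨e', by rw [mul_comm]; exact hjinj he⟩
    rw [huθ] at h1
    norm_num at h1
  -- ### the three cases (bimultiplicativity)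
  have hvb : Valued.v (jE (toPlace v w b)) = 1 := by rw [hb, hvf]
  have hvy0 : Valued.v (jE (toPlace v w y₀)) = 1 := by rw [hy₀, hvy]
  by_cases hbθ : hilbertSymbol (v.adicCompletion ↥(maximalRealSubfield L)) b θv = 1
  · by_cases hyc : hilbertSymbol (v.adicCompletion ↥(maximalRealSubfield L)) y₀ c = 1
    · -- `u := b·y₀`
      refine key (b * y₀) (mul_ne_zero hb0 hy00) (by rw [map_mul, map_mul, Valuation.map_mul, hvb, hvy0, mul_one]) ?_ ?_
      · rw [hilbertSymbol_adicCompletion_mul_left ↥(maximalRealSubfield L) v hb0 hy00 hθ0, hbθ, hyθ]; norm_num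
      · rw [hilbertSymbol_adicCompletion_mul_right ↥(maximalRealSubfield L) v hθ0 hc0 (mul_ne_zero hb0 hy00),
          hilbertSymbol_adicCompletion_mul_left ↥(maximalRealSubfield L) v hb0 hy00 hθ0,
          hilbertSymbol_adicCompletion_mul_left ↥(maximalRealSubfield L) v hb0 hy00 hc0, hbθ, hyθ, hbc, hyc]
        norm_num
    · -- `u := y₀`
      refine key y₀ hy00 hvy0 hyθ ?_
      rw [hilbertSymbol_adicCompletion_mul_right ↥(maximalRealSubfield L) v hθ0 hc0 hy00, hyθ, (hilbertSymbol_ne_one_iff _ _).1 hyc]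
      norm_num
  · -- `u := b`
    have hbθ' := (hilbertSymbol_ne_one_iff _ _).1 hbθ
    refine key b hb0 hvb hbθ' ?_
    rw [hilbertSymbol_adicCompletion_mul_right ↥(maximalRealSubfield L) v hθ0 hc0 hb0, hbθ', hbc]
    norm_num

include hw in
/-- **`hf♮` IN THE SOCKET LETTERS, TYPE RamM** — §1 + §2 assembled: `M ⊇ jE(L_w)` complete with finite residue field, `ρ` (`Fix ρ = jE(L_w)`), `Θ` (`Θ ∘ jE = jE ∘ σ_w`),
`τ = Θρ` residually trivial, `hF4`, `jE` integral both ways, the eigen-letter `lam`, a uniformiser `ϖM`, and the `E ∕ F` datum on `L_w`.  Output = the binder `hf` of Σ1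
`F0P3cDyRamSideNormCriterionRamM.side_iff_exists_norm_ramM` verbatim. [cite: Serre1979, Ch. V §3 Cor. 3 p. 86; Ch. XIV §2–§3] [cite: Rogawski1990, §4.9 Lemma 4.9.3 p. 56] -/
theorem exists_thetaFixed_unit_not_rhoNorm_ramM {M : Type} [Field M] [Valued M ℤᵐ⁰] [CompleteSpace M] [Finite 𝓀[M]]
    (jE : w.1.adicCompletion L →+* M) (ρ Θ τ : M →+* M) (hτ : ∀ x, τ x = Θ (ρ x))
    (hρρ : ∀ z, ρ (ρ z) = z) (hvρ : ∀ z, Valued.v (ρ z) = Valued.v z) (hΘΘ : ∀ z, Θ (Θ z) = z) (hvΘ : ∀ z, Valued.v (Θ z) = Valued.v z)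
    (hΘρ : ∀ z, Θ (ρ z) = ρ (Θ z)) (hjfix : ∀ z : M, ρ z = z ↔ ∃ a, jE a = z)
    (hΘj : ∀ a, Θ (jE a) = jE (galAdicCompletionMap (L := L) (IsCMField.complexConj L) hw a))
    (hjv : ∀ a, Valued.v (jE a) ≤ 1 ↔ Valued.v a ≤ 1)
    (hτres : ∀ x : M, Valued.v x ≤ 1 → Valued.v (x - τ x) < 1)
    (hF4 : ∀ f : M, ρ f = f → τ f = f → f ≠ 0 → ∃ n : ℤ, Valued.v f = exp (4 * n))
    {ϖM : M} (hϖM : Valued.v ϖM = exp (-1 : ℤ)) {lam : M} (hΘlam : Θ lam * lam = 1) (hρlam : ρ lam ≠ lam)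
    {ϖ : w.1.adicCompletion L} {d tE : ℕ} (hD : IsRamifiedQuadraticDatum (galAdicCompletionMap (L := L) (IsCMField.complexConj L) hw) ϖ d tE) :
    ∃ a : M, Θ a = a ∧ Valued.v a = 1 ∧ ¬ ∃ e : M, ρ e = e ∧ e * Θ e = a * ρ a := by
  classical
  haveI : CharZero (w.1.adicCompletion L) := charZero_of_injective_algebraMap (algebraMap L (w.1.adicCompletion L)).injective
  have h2M : (2 : M) ≠ 0 := by rw [← map_ofNat jE 2]; exact (map_ne_zero_iff jE jE.injective).2 two_ne_zero
  obtain ⟨f₁, hρf, hΘf, hvf, hfN⟩ := exists_fixed_fixed_unit_not_tauNorm hτ hρρ hvρ hΘΘ hvΘ hΘρ hτres hF4 h2M hϖM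
  obtain ⟨ξ, hξ0, hρξ, hΘξ⟩ := exists_antifixed_of_lam L w hw jE ρ Θ hρρ hjfix hΘj hΘρ hΘlam hρlam
  have hf₁ : ∃ f₁ : M, ρ f₁ = f₁ ∧ Θ f₁ = f₁ ∧ Valued.v f₁ = 1 ∧ ¬ ∃ k : M, Θ (ρ k) = k ∧ k * ρ k = f₁ :=
    ⟨f₁, hρf, hΘf, hvf, fun ⟨k, hk, hk'⟩ => hfN ⟨k, by rw [hτ]; exact hk, hk'⟩⟩
  exact exists_thetaFixed_unit_not_rhoNorm L w hw jE ρ Θ hvρ hjfix hΘj hξ0 hρξ hΘξ hf₁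
    (exists_fixed_fixed_unit_not_rhoNorm_of_datum L w hw jE ρ Θ hjfix hΘj hjv hD)

end CM

end Summit.HodgeConjecture.HodgeConjecture.Cruxes.H413.F0P3cDyRamFourthFieldNonNormUnit

end
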